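import Summits.HodgeConjecture.CorCM.Census.DecicWeil23TripleExtraction
import Summits.HodgeConjecture.CorCM.DecicWeil23TripleSixfoldParts
import Summits.HodgeConjecture.CorCM.DecicWeil23TripleTenfoldParts
import Summits.HodgeConjecture.CorCM.DecicWeil23PairRealisers
import Summits.HodgeConjecture.CorCM.DecicCurveFivefoldHodgeOfMarkman
import HarnessLib

/-!
# COR-CM — the Hodge conjecture for every product of copies of `E, B₁, B₂, B₃` — THREE CM fivefolds of `k`-signature `(2,3)`,
# pairwise distinct types, over one DECIC CM field `K ⊇ k`, and the CM curve of `k` — GIVEN ONLY Markman's hyperbolic-sixfold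
# theorem (frame form)

Cell `pub-hodgecm2` (COR-CM), seat b30 gen 22 (2026-08-22); count-neutral own lane DECIC-WEIL-23PAIR, part TRIPLE (three types; the
two-type assembly is `CorCM/DecicWeil23PairPowersHodgeOfMarkman`).  Theorems only; no definition, no named fact, no `sorry`.  HONEST FRAMING: CONDITIONAL on the single
displayed named fact `HodgeTheory.Markman2025_weilClasses_algebraic_hyperbolicSixfold` (E. Markman, arXiv:2502.03415 Thm 1.5.1 —
UNREFEREED); `HC_CM` is not asserted and no case of the Hodge conjecture is claimed unconditionally.

ASSEMBLY (setting and notation of `CorCM/DecicWeil23TripleFrameTransfer`).  For `X = ⨁_j A₄(κ j)` — any product of copies of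
`E = A₄ 0 ⊨ (k; {τ})` and `B_{m+1} = A₄ (m+1) ⊨ (K; Φ_m)`, the three `(2,3)`-types read in the frame `e` at the positions `posT c m` of
the shape `c` (`hΦ`) — every rational `(p,p)`-class is a sum of weight classes over `Aut(ℂ)`-balanced
weights (Pohlmann's theorem for the CM algebra `∏_j K_{κ j}`, `Pohlmann1968_thm1_cmAlgebra`); a balanced weight is a balanced
configuration of the kernel census (FRAME TRANSFER `modelBalancedT_of_isGaloisBalancedAlg`, the sixty even permutations being
realised: `hgal`, or `3`-transitivity `h3t` via `hgal_of_h3t`); a balanced configuration is a disjoint union of PAIR parts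
(divisor lines), Weil SIXFOLD parts of `B_m × E` (algebraic GIVEN the Weil plane of `(B_m × E, ι(iδ) × ι(δ))` —
`weightClassesAlg_le_algebraicClasses_of_isSixPartT` — which Markman's theorem supplies through seat b09's
`DecicCurveFivefold.weilClassesOf_le_algebraicClasses_cmFivefold_prod_cmCurve_of_markmanSixfold` and the type count `(3,3)`
`typeCount_eq_three_of_reading₅`) and TENFOLD parts of `B_m × B̄_{m'}` (PUSH-PULL through `E ⊞ E ⊞ X`:
`weightClassesAlg_le_algebraicClasses_of_isTenPartT`, fed by the sixfold parts of `E ⊞ E ⊞ X`) — `modelBalancedT_induction`;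
and products of algebraic weight lines over disjoint weights are algebraic (`PairWeights.weightClassesAlg_union_le_algebraicClasses`).

* **`hodgeConjectureFor_biproduct_comp_of_frameT_of_markmanSixfold`** (every even permutation realised, `hgal`),
  **`…_h3t`** (`3`-transitivity), and the `AVDominatedBy` forms (isogeny factors of powers).
The intrinsic form (no frame: `K ⊇ i(k)` decic, `Φ₁, Φ₂, Φ₃` pairwise distinct of `k`-signature `(2,3)`, `Aut(ℂ/k)` `3`-transitive
on the embeddings over `τ`) is the sequel `CorCM/DecicWeil23TripleHodgeOfMarkman.lean`.
[cite: Markman2025SecantWeil, Thm 1.5.1] [cite: Pohlmann1968, Thm 1] [cite: Milne2020HodgeClassesAV, 1.2 (a) and Thm. 1]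
[cite: Deligne1982HodgeCycles, §4 Prop. 4.4 and §5 (c)] [cite: MoonenZarhin1999LowDim, Thm. 0.1 (a)] [cite: Schoen1998HodgeWeilAddendum, §10]

## References
* [Markman2025SecantWeil] E. Markman, arXiv:2502.03415 (unrefereed), Thm 1.5.1.  [Pohlmann1968] H. Pohlmann, Ann. of Math. 88
  (1968), Thm 1.  [Milne2020HodgeClassesAV] J. S. Milne, arXiv:2010.08857, 1.2 (a), Thm. 1.  [Deligne1982HodgeCycles]
  P. Deligne, LNM 900 (1982), §4 Prop. 4.4, §5 (c).  [MoonenZarhin1999LowDim] B. Moonen, Yu. Zarhin, Math. Ann. 315 (1999),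
  Thm. 0.1 (a).  [Schoen1998HodgeWeilAddendum] C. Schoen, Compositio Math. 114 (1998), §10.  [MumfordAV1970] D. Mumford,
  *Abelian Varieties*, §19.
-/

noncomputable section

open CategoryTheory CategoryTheory.Limits NumberField

namespace Summit.HodgeConjecture.CorCM.DecicWeil23Triple

open Literature.AlgebraicGeometry Literature.AlgebraicGeometry.Motives Literature.AlgebraicGeometry.HodgeTheory
open Literature.AlgebraicGeometry.ComplexMultiplication (IsCMTypeRealisation)
open Literature.AlgebraicGeometry.Pohlmann1968
open Literature.AlgebraicTopology.SingularHomology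
open Literature.NumberTheory.ComplexMultiplication
open Summit.HodgeConjecture.CorCM.Census.DecicWeil23Pair (permD)
open Summit.HodgeConjecture.CorCM.Census.DecicWeil23Triple (PtT inPosT card_inPosT ModelBalancedT IsPairPartT IsSixPartT IsTenPartT
  modelBalancedT_induction)
open Summit.HodgeConjecture.CorCM.DecicWeil23Pair (hgal_of_h3t)
open Summit.HodgeConjecture.CorCM.OcticWeilOrbit (orbitSlots)
open Summit.HodgeConjecture.CorCM.DecicCurveFivefold (weilClassesOf_le_algebraicClasses_cmFivefold_prod_cmCurve_of_markmanSixfold)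
open Summit.HodgeConjecture.CorCM.PairWeights

open scoped Classical Pointwise

section Assembly

variable {I : Type} {Kf : I → Type} [∀ i, Field (Kf i)] [∀ i, NumberField (Kf i)] [∀ i, IsCMField (Kf i)]
  {i₀ i₁ : I} {τ : Kf i₀ →+* ℂ} {e : (Kf i₁ →+* ℂ) ≃ Fin 5 × Bool} {i : Kf i₀ →+* Kf i₁} {c : Fin 8}
  {A₄ : Fin 4 → AbelianVariety ℂ} {Φ₄ : ∀ j : Fin 4, CMType (Kf (orbitSlots i₀ i₁ j))}
  {ι₄ : ∀ j, 𝓞 (Kf (orbitSlots i₀ i₁ j)) →+* End (A₄ j)}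
  {θ₄ : ∀ j, Kf (orbitSlots i₀ i₁ j) →+* Module.End ℂ (complexBetti (A₄ j).X 1)}

/-! ### The Weil planes of the two sixfolds `B_m × E`, from Markman's theorem -/

/-- **The Weil planes of the sixfolds `(B_m × E, ι(iδ) × ι(δ))` are algebraic, GIVEN Markman's hyperbolic-sixfold theorem** — seat
b09's aiming theorem `DecicCurveFivefold.weilClassesOf_le_algebraicClasses_cmFivefold_prod_cmCurve_of_markmanSixfold` (Weil type
`(3,3)`; split polarisation by ring 2's `isSplitWeilType_odd_prod_curve`) fed with the type count read off the frame.
[cite: Markman2025SecantWeil, Thm 1.5.1] [cite: MoonenZarhin1999LowDim, Thm. 0.1 (a)] [cite: Deligne1982HodgeCycles, §4 Prop. 4.4] -/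
theorem weilClassesOf_sixfold_le_algebraicClasses_of_frameT_of_markmanSixfold
    (hM6 : Markman2025_weilClasses_algebraic_hyperbolicSixfold)
    (h10 : Module.finrank ℚ (Kf i₁) = 10) (h2 : Module.finrank ℚ (Kf i₀) = 2) (i : Kf i₀ →+* Kf i₁)
    {δ : 𝓞 (Kf i₀)} {d : ℕ} (hd : 0 < d) (hδ : ((δ : Kf i₀)) ^ 2 = -(d : Kf i₀))
    (hA : ∀ j, IsCMTypeRealisation (Φ₄ j) (A₄ j) (ι₄ j) (θ₄ j))
    (he_sign : ∀ s : Kf i₁ →+* ℂ, (e s).2 = true ↔ s.comp i = τ)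
    (hΦ : ∀ (m : Fin 3) (s : Kf i₁ →+* ℂ), s ∈ (Φ₄ m.succ).1 ↔ (e s).2 = inPosT c m (e s).1)
    (hΨ : ∀ σ : Kf i₀ →+* ℂ, σ ∈ (Φ₄ 0).1 ↔ σ = τ) (m : Fin 3) :
    weilClassesOf ((A₄ m.succ).prod (A₄ 0))
      (AbelianVariety.prodLift (AbelianVariety.fst (A₄ m.succ) (A₄ 0) ≫ ι₄ m.succ (RingOfIntegers.mapRingHom i δ))
        (AbelianVariety.snd (A₄ m.succ) (A₄ 0) ≫ ι₄ 0 δ)) 3 d ≤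
      algebraicClasses ((A₄ m.succ).prod (A₄ 0)).X 3 :=
  weilClassesOf_le_algebraicClasses_cmFivefold_prod_cmCurve_of_markmanSixfold hM6 h10 h2 i (hA m.succ) (hA 0) hd hδ
    (typeCount_eq_three_of_reading₅ h2 he_sign (card_inPosT c m) (hΦ m) hΨ)

/-! ### Assembly -/

/-- **MAIN THEOREM (frame form).  The Hodge conjecture for every product of copies `⨁_j A₄(κ j)` of `E, B₁, B₂` — i.e. for
`E^a × B₁^{n₁} × B₂^{n₂} × B₃^{n₃}`, all exponents, any order — GIVEN ONLY Markman's hyperbolic-sixfold theorem**, for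
`E ⊨ (k; {τ})` (`δ ∈ 𝓞_k`, `δ² = −d`, `τ(δ) = i√d`), `B_{m+1} ⊨ (K; Φ_m)` CM fivefolds of `k`-signature `(2,3)` over a decic CM field
`K ⊇ i(k)`, the types read in a frame `e` at the positions `posT c m` of a shape `c` (`hΦ`), whose conjugate pairs admit every EVEN
permutation under `Aut(ℂ)` (`hgal`).  Leaf: the Markman fact ONLY.
[cite: Markman2025SecantWeil, Thm 1.5.1] [cite: Pohlmann1968, Thm 1] [cite: Milne2020HodgeClassesAV, 1.2 (a) and Thm. 1]
[cite: Schoen1998HodgeWeilAddendum, §10] -/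
theorem hodgeConjectureFor_biproduct_comp_of_frameT_of_markmanSixfold
    (hM6 : Markman2025_weilClasses_algebraic_hyperbolicSixfold)
    {N : ℕ} (κ : Fin N → Fin 4) (h10 : Module.finrank ℚ (Kf i₁) = 10) (h2 : Module.finrank ℚ (Kf i₀) = 2) (i : Kf i₀ →+* Kf i₁)
    {δ : 𝓞 (Kf i₀)} {d : ℕ} (hd : 0 < d) (hδ : ((δ : Kf i₀)) ^ 2 = -(d : Kf i₀))
    (hτ : τ (δ : Kf i₀) = Complex.I * (Real.sqrt d : ℂ))
    (hA : ∀ j, IsCMTypeRealisation (Φ₄ j) (A₄ j) (ι₄ j) (θ₄ j))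
    (e : (Kf i₁ →+* ℂ) ≃ Fin 5 × Bool)
    (he_sign : ∀ s : Kf i₁ →+* ℂ, (e s).2 = true ↔ s.comp i = τ)
    (he_conj : ∀ s : Kf i₁ →+* ℂ, e (ComplexEmbedding.conjugate s) = ((e s).1, !(e s).2))
    (hΦ : ∀ (m : Fin 3) (s : Kf i₁ →+* ℂ), s ∈ (Φ₄ m.succ).1 ↔ (e s).2 = inPosT c m (e s).1)
    (hΨ : ∀ σ : Kf i₀ →+* ℂ, σ ∈ (Φ₄ 0).1 ↔ σ = τ)
    (hgal : ∀ r : Fin 60, ∃ ρ : ℂ ≃+* ℂ,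
      ∀ a : Fin 5, (ρ : ℂ →+* ℂ).comp (e.symm (a, true)) = e.symm (permD r a, true)) :
    HodgeConjectureFor (⨁ fun j => A₄ (κ j)).dim (⨁ fun j => A₄ (κ j)).X := by
  have hττ : ComplexEmbedding.conjugate τ ≠ τ := QuarticCM.conjugate_ne τ
  have hk : ∀ σ : Kf i₀ →+* ℂ, σ = τ ∨ σ = ComplexEmbedding.conjugate τ := fun σ =>
    QuarticCM.eq_or_eq_conjugate_of_quadratic h2 τ σ
  -- the Weil planes of the `B_m × E`, algebraic by Markman's sixfold theorem
  have hW := weilClassesOf_sixfold_le_algebraicClasses_of_frameT_of_markmanSixfold hM6 h10 h2 i hd hδ hA he_sign hΦ hΨ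
  -- sixfold parts of any product of copies (used on `X` and on `X⁺ = E ⊞ E ⊞ X`)
  have hsix : ∀ {N' : ℕ} (κ' : Fin N' → Fin 4) (m : Fin 3) (c' : Bool)
      (G' : Finset ((j : Fin N') × (Kf (orbitSlots i₀ i₁ (κ' j)) →+* ℂ))),
      IsSixPartT (fun x => toPtT e τ ((Sigma.map κ' (fun _ => id) :
        ((j : Fin N') × (Kf (orbitSlots i₀ i₁ (κ' j)) →+* ℂ)) → ((l : Fin 4) × (Kf (orbitSlots i₀ i₁ l) →+* ℂ))) x)) m c' G' →
      G'.card = 2 * 3 ∧ weightClassesAlg (fun j => A₄ (κ' j)) (fun j => ι₄ (κ' j)) (2 * 3) G' ≤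
        algebraicClasses (⨁ fun j => A₄ (κ' j)).X 3 :=
    fun κ' m c' G' hG' => weightClassesAlg_le_algebraicClasses_of_isSixPartT hk he_sign hA hτ hW κ' hG'
  refine ⟨nonempty_hodgeModel_holds (Motives.AbelianVariety.isSmoothProjective_holds (A := ⨁ fun j => A₄ (κ j))),
    fun p cl hc hH => ?_⟩
  have hAκ : ∀ j, IsCMTypeRealisation (Φ₄ (κ j)) (A₄ (κ j)) (ι₄ (κ j)) (θ₄ (κ j)) := fun j => hA (κ j)
  -- every balanced configuration has algebraic weight lines: induct over its generating parts
  have key : ∀ (R : Finset ((j : Fin N) × (Kf (orbitSlots i₀ i₁ (κ j)) →+* ℂ))),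
      ModelBalancedT c (fun x => toPtT e τ ((Sigma.map κ (fun _ => id) :
        ((j : Fin N) × (Kf (orbitSlots i₀ i₁ (κ j)) →+* ℂ)) → ((m : Fin 4) × (Kf (orbitSlots i₀ i₁ m) →+* ℂ))) x)) R →
      ∀ q, R.card = 2 * q → weightClassesAlg (fun j => A₄ (κ j)) (fun j => ι₄ (κ j)) (2 * q) R ≤
        algebraicClasses (⨁ fun j => A₄ (κ j)).X q := by
    intro R hR
    refine modelBalancedT_induction (motive := fun R => ∀ q, R.card = 2 * q →
      weightClassesAlg (fun j => A₄ (κ j)) (fun j => ι₄ (κ j)) (2 * q) R ≤ algebraicClasses (⨁ fun j => A₄ (κ j)).X q)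
      (fun q hq => ?_) (fun G R hGR hG ih q hq => ?_) (fun G R m b hGR hG ih q hq => ?_)
      (fun G R m₁ m₂ hGR hG ih q hq => ?_) hR
    · obtain rfl : q = 0 := by simpa using hq.symm
      exact fun c' _ => hodgeConjectureFor_codim_zero c'
    · -- a pair part: a divisor line
      obtain ⟨ha, hGalg⟩ := weightClassesAlg_le_algebraicClasses_of_isPairPartT κ hττ hk he_conj hA hG
      have hRcard : R.card = 2 * (q - 1) := by
        have h := Finset.card_union_of_disjoint hGR; rw [hq, ha] at h; omega
      have haq : 1 + (q - 1) = q := by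
        have h := Finset.card_union_of_disjoint hGR; rw [hq, ha] at h; omega
      rw [← Finset.disjUnion_eq_union G R hGR]
      exact weightClassesAlg_union_le_algebraicClasses hAκ haq ha hRcard hGR hGalg (ih (q - 1) hRcard)
    · -- a sixfold part of `B_m × E`: Markman's sixfold theorem
      obtain ⟨ha, hGalg⟩ := hsix κ m b G hG
      have hRcard : R.card = 2 * (q - 3) := by
        have h := Finset.card_union_of_disjoint hGR; rw [hq, ha] at h; omega
      have haq : 3 + (q - 3) = q := by
        have h := Finset.card_union_of_disjoint hGR; rw [hq, ha] at h; omega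
      rw [← Finset.disjUnion_eq_union G R hGR]
      exact weightClassesAlg_union_le_algebraicClasses hAκ haq ha hRcard hGR hGalg (ih (q - 3) hRcard)
    · -- a tenfold part of `B_{m₁} × B̄_{m₂}`: push-pull through `E ⊞ E ⊞ X`, the sixfold parts there
      obtain ⟨ha, hGalg⟩ := weightClassesAlg_le_algebraicClasses_of_isTenPartT κ hττ hk he_conj hA
        (fun m c' G' hG' => (hsix (extT₂ κ) m c' G' hG').2) hG
      have hRcard : R.card = 2 * (q - 5) := by
        have h := Finset.card_union_of_disjoint hGR; rw [hq, ha] at h; omega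
      have haq : 5 + (q - 5) = q := by
        have h := Finset.card_union_of_disjoint hGR; rw [hq, ha] at h; omega
      rw [← Finset.disjUnion_eq_union G R hGR]
      exact weightClassesAlg_union_le_algebraicClasses hAκ haq ha hRcard hGR hGalg (ih (q - 5) hRcard)
  have hmem : cl ∈ ⨆ S ∈ pohlmannSetsAlg (K := fun j => Kf (orbitSlots i₀ i₁ (κ j))) (fun j => Φ₄ (κ j)) p,
      weightClassesAlg (fun j => A₄ (κ j)) (fun j => ι₄ (κ j)) (2 * p) S := by
    rw [← (Pohlmann1968_thm1_cmAlgebra (fun j => Kf (orbitSlots i₀ i₁ (κ j))) (fun j => A₄ (κ j))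
      (fun j => Φ₄ (κ j)) (fun j => ι₄ (κ j)) (fun j => θ₄ (κ j)) hAκ p).1]
    exact Submodule.subset_span ⟨hc, hH⟩
  have hle : (⨆ S ∈ pohlmannSetsAlg (K := fun j => Kf (orbitSlots i₀ i₁ (κ j))) (fun j => Φ₄ (κ j)) p,
      weightClassesAlg (fun j => A₄ (κ j)) (fun j => ι₄ (κ j)) (2 * p) S) ≤
      algebraicClasses (⨁ fun j => A₄ (κ j)).X p := by
    refine iSup₂_le fun S hS => ?_
    exact key S (modelBalancedT_of_isGaloisBalancedAlg hττ hk he_sign he_conj hΦ hΨ κ hgal hS.2) p hS.1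
  exact hle hmem

/-- **The frame form under `3`-TRANSITIVITY** (`h3t`: every ordered triple of distinct conjugate pairs is moved to `(0, 1, 2)`
by an automorphism of `ℂ` — the totally real quintic `K⁺` has Galois group `A₅` or `S₅`): the sixty even permutations are
realised by `hgal_of_h3t`. [cite: Markman2025SecantWeil, Thm 1.5.1] [cite: DixonMortimer1996, Thm 7.6A] -/
theorem hodgeConjectureFor_biproduct_comp_of_frameT_of_markmanSixfold_h3t
    (hM6 : Markman2025_weilClasses_algebraic_hyperbolicSixfold)
    {N : ℕ} (κ : Fin N → Fin 4) (h10 : Module.finrank ℚ (Kf i₁) = 10) (h2 : Module.finrank ℚ (Kf i₀) = 2) (i : Kf i₀ →+* Kf i₁)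
    {δ : 𝓞 (Kf i₀)} {d : ℕ} (hd : 0 < d) (hδ : ((δ : Kf i₀)) ^ 2 = -(d : Kf i₀))
    (hτ : τ (δ : Kf i₀) = Complex.I * (Real.sqrt d : ℂ))
    (hA : ∀ j, IsCMTypeRealisation (Φ₄ j) (A₄ j) (ι₄ j) (θ₄ j))
    (e : (Kf i₁ →+* ℂ) ≃ Fin 5 × Bool)
    (he_sign : ∀ s : Kf i₁ →+* ℂ, (e s).2 = true ↔ s.comp i = τ)
    (he_conj : ∀ s : Kf i₁ →+* ℂ, e (ComplexEmbedding.conjugate s) = ((e s).1, !(e s).2))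
    (hΦ : ∀ (m : Fin 3) (s : Kf i₁ →+* ℂ), s ∈ (Φ₄ m.succ).1 ↔ (e s).2 = inPosT c m (e s).1)
    (hΨ : ∀ σ : Kf i₀ →+* ℂ, σ ∈ (Φ₄ 0).1 ↔ σ = τ)
    (h3t : ∀ a b c' : Fin 5, a ≠ b → a ≠ c' → b ≠ c' → ∃ ρ : ℂ ≃+* ℂ,
      (ρ : ℂ →+* ℂ).comp (e.symm (a, true)) = e.symm (0, true) ∧ (ρ : ℂ →+* ℂ).comp (e.symm (b, true)) = e.symm (1, true) ∧
        (ρ : ℂ →+* ℂ).comp (e.symm (c', true)) = e.symm (2, true)) :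
    HodgeConjectureFor (⨁ fun j => A₄ (κ j)).dim (⨁ fun j => A₄ (κ j)).X :=
  hodgeConjectureFor_biproduct_comp_of_frameT_of_markmanSixfold hM6 κ h10 h2 i hd hδ hτ hA e he_sign he_conj hΦ hΨ
    (hgal_of_h3t he_sign h3t)

/-- **The Hodge conjecture for every abelian variety dominated by a product of copies `⨁_j A₄(κ j)`** (frame form, `3`-transitivity,
modulo Markman's sixfold theorem): every abelian variety isogenous to a product of copies of `E, B₁, B₂, B₃` and their abelian
subvarieties and quotients. [cite: Markman2025SecantWeil, Thm 1.5.1] [cite: MumfordAV1970, §19] -/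
theorem hodgeConjectureFor_of_avDominatedBy_comp_of_frameT_of_markmanSixfold_h3t
    (hM6 : Markman2025_weilClasses_algebraic_hyperbolicSixfold)
    {N : ℕ} (κ : Fin N → Fin 4) (h10 : Module.finrank ℚ (Kf i₁) = 10) (h2 : Module.finrank ℚ (Kf i₀) = 2) (i : Kf i₀ →+* Kf i₁)
    {δ : 𝓞 (Kf i₀)} {d : ℕ} (hd : 0 < d) (hδ : ((δ : Kf i₀)) ^ 2 = -(d : Kf i₀))
    (hτ : τ (δ : Kf i₀) = Complex.I * (Real.sqrt d : ℂ))
    (hA : ∀ j, IsCMTypeRealisation (Φ₄ j) (A₄ j) (ι₄ j) (θ₄ j))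
    (e : (Kf i₁ →+* ℂ) ≃ Fin 5 × Bool)
    (he_sign : ∀ s : Kf i₁ →+* ℂ, (e s).2 = true ↔ s.comp i = τ)
    (he_conj : ∀ s : Kf i₁ →+* ℂ, e (ComplexEmbedding.conjugate s) = ((e s).1, !(e s).2))
    (hΦ : ∀ (m : Fin 3) (s : Kf i₁ →+* ℂ), s ∈ (Φ₄ m.succ).1 ↔ (e s).2 = inPosT c m (e s).1)
    (hΨ : ∀ σ : Kf i₀ →+* ℂ, σ ∈ (Φ₄ 0).1 ↔ σ = τ)
    (h3t : ∀ a b c' : Fin 5, a ≠ b → a ≠ c' → b ≠ c' → ∃ ρ : ℂ ≃+* ℂ,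
      (ρ : ℂ →+* ℂ).comp (e.symm (a, true)) = e.symm (0, true) ∧ (ρ : ℂ →+* ℂ).comp (e.symm (b, true)) = e.symm (1, true) ∧
        (ρ : ℂ →+* ℂ).comp (e.symm (c', true)) = e.symm (2, true))
    {X : AbelianVariety ℂ} (hX : Domination.AVDominatedBy X (⨁ fun j => A₄ (κ j))) :
    HodgeConjectureFor X.dim X.X :=
  Domination.hodgeConjectureFor_of_avDominatedBy
    (hodgeConjectureFor_biproduct_comp_of_frameT_of_markmanSixfold_h3t hM6 κ h10 h2 i hd hδ hτ hA e he_sign he_conj hΦ hΨ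
      h3t) hX

end Assembly

end Summit.HodgeConjecture.CorCM.DecicWeil23Triple

end
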